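/-
Copyright (c) 2026 the pub-hodgecm-mathlib formalisation cell (harness21).  Prover seat hodgecm-mathlib-LH4-p06 (g3): Track A «(D-RAM) FOUR-FRAME» squad of crux H413, unit
U3_Laws, (KMS) road «MODULO κ-STAGE B», brick κB-H «CORE-HANGING κ-SOCKETS» FILE (B1b) «CHARACTER SUMS» (dealer LH4-plan (g11) WORDS #34∕#43), 2026-09-04.
-/
import Summits.HodgeConjecture.HodgeConjecture.Theorems.F0P3cDyRamDiagonalKappaCoreHangingCharacterMaps   -- FILE (B1a) (this seat): the involutions, the toolkit §5 wrappers, transport of representative systems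
import HarnessLib

/-!
# Crux `H413`, (KMS) ROAD «MODULO κ-STAGE B», brick κB-H FILE (B1b): THE THREE CHARACTER SUMS OVER THE CORE-HANGING CLASS REPRESENTATIVES

Cell `hodgecm-mathlib` (D-0151), FLOOR 0, crux item H413 = `stmt-HodgeConjecture-24833`; lane `--supports stmt-HodgeConjecture-24833 --as helper` (count-neutral).  THEOREMS ONLY
(no `def`, no instance, no notation, no `sorry`, default heartbeats).  Interface letter `LETTER-kappaBH-B1B2-interface.v1.LH4p06g3.md` fcf05c88590d5f17 §1 — the three names and
conclusions below are the FROZEN interface consumed by LH4-p08 (g3)'s FILE (B2) `…KappaCoreHangingSocket`.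

THE MATHEMATICS (LH4-p06 (g3) head letter da173de2 (F3)).  By FILE (A2) the κ-count of the core-hanging lattice with exact invariant `g` (a fixed unit, `|1+g| = 1`) is
`[2d−1 ≤ ρ]·χ^H_i(g)`, `(χ^H_0, χ^H_1, χ^H_2)(g) = (ω(−(1+g)), ω(g)ω(−(1+g)), ω(g))` — spelled out below as a `Fin 3 → ℤ` vector, no definition is introduced.  For a complete
irredundant system `R` of representatives of the fixed units modulo `𝔭^ρ` (the letters `hRfin hR1 hR2 hR3` of ★ `exists_fixed_class_representatives … ρ 0`):
* (T1) `finsum_chiH_admissible_eq_zero` — TUBE, `2d−1 ≤ ρ`: `Σ_{g ∈ R, |1+g| = 1} χ^H_i(g) = 0` (each sum is `Σ_S ω` over a complete irredundant system of representatives of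
  the admissible units — `S`, its image under `g ↦ −(1+g)`, its image under `g ↦ −g∕(1+g)` — and vanishes by FILE (B1a) §2);
* (T2a) `finsum_chiH_glue_eq_zero` — GLUE BALL `{g ∈ R : |g + g₀| ≤ |ϖ|^e}`, `|g₀| = |1−g₀| = 1`, `1 ≤ e ≤ min(ρ, 2d−2)`: the three sums vanish (ball version of the same);
* (T2b) `finsum_chiH_glue_eq_ncard_mul` — GLUE BALL with `2d−1 ≤ e`: the sum is `#{g ∈ R : |g + g₀| ≤ |ϖ|^e} · χ^H_i(f₀)` for any fixed `f₀` in the ball (toolkit §3).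
HONEST LABEL.  Count-neutral; `HC_CM` is proved only modulo the 7 printed citations (2 remaining named inputs: hLiu418 = `stmt-HodgeConjecture-24832`, h413 = `stmt-HodgeConjecture-24833`)
until rung 0 closes.

## References
* [Kottwitz1986BaseChangeUnits] R. Kottwitz, *Base change for unit elements of Hecke algebras*, Compositio Math. 60 (1986), §1 pp. 240–241 (κ-orbital integrals as signed lattice counts).
* [Rogawski1990] J. D. Rogawski, *Automorphic Representations of Unitary Groups in Three Variables*, Ann. of Math. Stud. 123 (1990), §4.9 Prop. 4.9.1 (a) p. 55; §4.10 p. 58.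
* [Serre1979] J.-P. Serre, *Local Fields*, GTM 67 (1979), Ch. V §3 Cor. 3 (p. 85), Ch. XV §2 (the norm groups and the conductor of the quadratic character).
-/

set_option autoImplicit false

noncomputable section

namespace Summit.HodgeConjecture.HodgeConjecture.Cruxes.H413.F0P3cDyRamDiagonalKappaCoreHangingCharacterSums

open WithZero Matrix
open Literature.NumberTheory.Automorphic.UnitaryThreeFourFrame
open Literature.NumberTheory.LocalFields.WildQuadraticDatum
open Summit.HodgeConjecture.HodgeConjecture.Cruxes.H413.F0P3cDyRamDiagonalKappaCoreHangingCharacterMaps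
open scoped Valued

variable {K : Type} [Field K] [Valued K ℤᵐ⁰]

/-! ## §1 (T1) The tube: the three admissible character sums vanish -/

/-- **(T1) `Σ_{g ∈ R, |1+g| = 1} χ^H_i(g) = 0`** for `2d−1 ≤ ρ` and a complete irredundant system `R` of representatives of the fixed units modulo `𝔭^ρ` (letters of
★ `exists_fixed_class_representatives … ρ 0`), `i = 0, 1, 2`. [cite: Kottwitz1986BaseChangeUnits, §1 pp. 240–241] [cite: Serre1979, Ch. V §3 Cor. 3; Ch. XV §2] -/
theorem finsum_chiH_admissible_eq_zero [CompleteSpace K] [Finite 𝓀[K]] {σ : K →+* K} {ϖ : K} {d t : ℕ}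
    (hD : IsRamifiedQuadraticDatum σ ϖ d t) (h2 : Valued.v (2 : K) < 1) {ρ : ℕ} (hρ : 2 * d - 1 ≤ ρ)
    {R : Set K} (hRfin : R.Finite) (hR1 : ∀ g ∈ R, σ g = g ∧ Valued.v g = 1)
    (hR2 : ∀ f : K, σ f = f → Valued.v f = 1 → ∃ g ∈ R, Valued.v (f - g) ≤ Valued.v ϖ ^ ρ)
    (hR3 : ∀ g ∈ R, ∀ g' ∈ R, Valued.v (g - g') ≤ Valued.v ϖ ^ ρ → g = g') (i : Fin 3) :
    ∑ᶠ g ∈ {g : K | g ∈ R ∧ Valued.v (1 + g) = 1},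
      (((![normSign σ (-(1 + g)), normSign σ g * normSign σ (-(1 + g)), normSign σ g] : Fin 3 → ℤ) i : ℤ) : ℚ) = 0 := by
  classical
  have hϖ := hD.2.2.1
  have hd1 := hD.2.2.2.2.2.1
  have hϖ1 : Valued.v ϖ < 1 := by rw [hϖ, ← exp_zero, exp_lt_exp]; norm_num
  have hpρ : Valued.v ϖ ^ ρ < 1 := pow_lt_one₀ zero_le hϖ1 (by omega)
  have hAfin : {g : K | g ∈ R ∧ Valued.v (1 + g) = 1}.Finite := hRfin.subset fun g hg => hg.1
  rw [finsum_mem_eq_finite_toFinset_sum _ hAfin]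
  set S := hAfin.toFinset with hSdef
  have hmem : ∀ g, g ∈ S ↔ g ∈ R ∧ Valued.v (1 + g) = 1 := fun g => Set.Finite.mem_toFinset hAfin
  -- `S` is a complete irredundant system of representatives of the admissible fixed units
  have hS1 : ∀ g ∈ S, σ g = g ∧ Valued.v g = 1 ∧ Valued.v (1 + g) = 1 := fun g hg =>
    ⟨(hR1 g ((hmem g).1 hg).1).1, (hR1 g ((hmem g).1 hg).1).2, ((hmem g).1 hg).2⟩
  have hS2 : ∀ f : K, σ f = f → Valued.v f = 1 → Valued.v (1 + f) = 1 → ∃ g ∈ S, Valued.v (f - g) ≤ Valued.v ϖ ^ ρ := by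
    intro f hσf hf h1f
    obtain ⟨g, hgR, hfg⟩ := hR2 f hσf hf
    refine ⟨g, (hmem g).2 ⟨hgR, ?_⟩, hfg⟩
    rw [show 1 + g = (1 + f) + -(f - g) by ring]
    exact v_add_eq_one_of_lt h1f (by rw [Valuation.map_neg]; exact hfg.trans_lt hpρ)
  have hS3 : ∀ g ∈ S, ∀ g' ∈ S, Valued.v (g - g') ≤ Valued.v ϖ ^ ρ → g = g' :=
    fun g hg g' hg' h => hR3 g ((hmem g).1 hg).1 g' ((hmem g').1 hg').1 h
  fin_cases i
  · -- `χ^H_0 = ω ∘ (g ↦ −(1+g))`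
    simp only [Fin.zero_eta, Fin.isValue, cons_val_zero]
    obtain ⟨h1, h2', h3⟩ := repr_admissible_image_neg_one_add S hS1 hS2 hS3
    have hinj : Set.InjOn (fun g : K => -(1 + g)) ↑S := fun g _ g' _ h => by simpa using h
    rw [← Int.cast_sum, ← Finset.sum_image hinj, sum_normSign_eq_zero_of_repr_admissible hD h2 hρ _ h1 h2' h3, Int.cast_zero]
  · -- `χ^H_1 = ω ∘ (g ↦ −g∕(1+g))`
    simp only [Fin.mk_one, Fin.isValue, cons_val_one, cons_val_zero]
    rw [← Int.cast_sum, Finset.sum_congr rfl fun g hg => normSign_mul_normSign_neg_one_add hD (hS1 g hg).1 (hS1 g hg).2.1 (hS1 g hg).2.2]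
    obtain ⟨h1, h2', h3⟩ := repr_admissible_image_moebius S hS1 hS2 hS3
    have hinj : Set.InjOn (fun g : K => -g / (1 + g)) ↑S := by
      intro g hg g' hg' h
      have h1g0 : (1 : K) + g ≠ 0 := fun h0 => by have := (hS1 g hg).2.2; rw [h0, map_zero] at this; exact zero_ne_one this
      have h1g'0 : (1 : K) + g' ≠ 0 := fun h0 => by have := (hS1 g' hg').2.2; rw [h0, map_zero] at this; exact zero_ne_one this
      have h' := congrArg (fun x : K => -x / (1 + x)) h
      simp only at h'
      rwa [moebius_moebius h1g0, moebius_moebius h1g'0] at h'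
    rw [← Finset.sum_image hinj, sum_normSign_eq_zero_of_repr_admissible hD h2 hρ _ h1 h2' h3, Int.cast_zero]
  · -- `χ^H_2 = ω`
    simp only [Fin.reduceFinMk, cons_val_two, Nat.succ_eq_add_one, Nat.reduceAdd, tail_cons, head_cons]
    rw [← Int.cast_sum, sum_normSign_eq_zero_of_repr_admissible hD h2 hρ S hS1 hS2 hS3, Int.cast_zero]

/-! ## §2 (T2a) The glue ball with `e ≤ 2d − 2`: the three sums vanish -/

/-- **(T2a) `Σ_{g ∈ R, |g + g₀| ≤ |ϖ|^e} χ^H_i(g) = 0`** for `2d−1 ≤ ρ`, `|g₀| = |1 − g₀| = 1`, `1 ≤ e ≤ ρ`, `e ≤ 2d−2` (the glue ball is `U_F(2d−2)`-stable and `ω` is non-trivial on it).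
[cite: Kottwitz1986BaseChangeUnits, §1 pp. 240–241] [cite: Serre1979, Ch. V §3 Cor. 3; Ch. XV §2] -/
theorem finsum_chiH_glue_eq_zero [CompleteSpace K] [Finite 𝓀[K]] {σ : K →+* K} {ϖ : K} {d t : ℕ}
    (hD : IsRamifiedQuadraticDatum σ ϖ d t) (h2 : Valued.v (2 : K) < 1) {ρ : ℕ} (hρ : 2 * d - 1 ≤ ρ)
    {R : Set K} (hRfin : R.Finite) (hR1 : ∀ g ∈ R, σ g = g ∧ Valued.v g = 1)
    (hR2 : ∀ f : K, σ f = f → Valued.v f = 1 → ∃ g ∈ R, Valued.v (f - g) ≤ Valued.v ϖ ^ ρ)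
    (hR3 : ∀ g ∈ R, ∀ g' ∈ R, Valued.v (g - g') ≤ Valued.v ϖ ^ ρ → g = g')
    {g₀ : K} (hg₀ : Valued.v g₀ = 1) (h1g₀ : Valued.v (1 - g₀) = 1) {e : ℕ} (he1 : 1 ≤ e) (heρ : e ≤ ρ) (hed : e ≤ 2 * d - 2) (i : Fin 3) :
    ∑ᶠ g ∈ {g : K | g ∈ R ∧ Valued.v (g + g₀) ≤ Valued.v ϖ ^ e},
      (((![normSign σ (-(1 + g)), normSign σ g * normSign σ (-(1 + g)), normSign σ g] : Fin 3 → ℤ) i : ℤ) : ℚ) = 0 := by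
  classical
  have hϖ := hD.2.2.1
  have hϖ1 : Valued.v ϖ < 1 := by rw [hϖ, ← exp_zero, exp_lt_exp]; norm_num
  have hpe : Valued.v ϖ ^ e < 1 := pow_lt_one₀ zero_le hϖ1 (by omega)
  have hρe : Valued.v ϖ ^ ρ ≤ Valued.v ϖ ^ e := by rw [v_varpi_pow hϖ, v_varpi_pow hϖ, exp_le_exp]; omega
  -- the centre `c₀ = −g₀` and its letters
  have hc₀ : Valued.v (-g₀) = 1 := by rw [Valuation.map_neg, hg₀]
  have h1c₀ : Valued.v (1 + -g₀) = 1 := by rw [← sub_eq_add_neg, h1g₀]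
  have hAfin : {g : K | g ∈ R ∧ Valued.v (g + g₀) ≤ Valued.v ϖ ^ e}.Finite := hRfin.subset fun g hg => hg.1
  rw [finsum_mem_eq_finite_toFinset_sum _ hAfin]
  set S := hAfin.toFinset with hSdef
  have hmem : ∀ g, g ∈ S ↔ g ∈ R ∧ Valued.v (g + g₀) ≤ Valued.v ϖ ^ e := fun g => Set.Finite.mem_toFinset hAfin
  -- `S` is a complete irredundant system of representatives of the fixed units of the ball `|g − (−g₀)| ≤ |ϖ|^e`
  have hS1 : ∀ g ∈ S, σ g = g ∧ Valued.v g = 1 ∧ Valued.v (g - -g₀) ≤ Valued.v ϖ ^ e := fun g hg =>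
    ⟨(hR1 g ((hmem g).1 hg).1).1, (hR1 g ((hmem g).1 hg).1).2, by rw [sub_neg_eq_add]; exact ((hmem g).1 hg).2⟩
  have hS2 : ∀ f : K, σ f = f → Valued.v f = 1 → Valued.v (f - -g₀) ≤ Valued.v ϖ ^ e → ∃ g ∈ S, Valued.v (f - g) ≤ Valued.v ϖ ^ ρ := by
    intro f hσf hf hfc
    obtain ⟨g, hgR, hfg⟩ := hR2 f hσf hf
    refine ⟨g, (hmem g).2 ⟨hgR, ?_⟩, hfg⟩
    rw [show g + g₀ = (f - -g₀) - (f - g) by ring]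
    exact Valuation.map_sub_le _ hfc (hfg.trans hρe)
  have hS3 : ∀ g ∈ S, ∀ g' ∈ S, Valued.v (g - g') ≤ Valued.v ϖ ^ ρ → g = g' :=
    fun g hg g' hg' h => hR3 g ((hmem g).1 hg).1 g' ((hmem g').1 hg').1 h
  have h1S : ∀ g ∈ S, Valued.v (1 + g) = 1 := fun g hg => by
    rw [show 1 + g = (1 + -g₀) + (g - -g₀) by ring]; exact v_add_eq_one_of_lt h1c₀ ((hS1 g hg).2.2.trans_lt hpe)
  fin_cases i
  · -- `χ^H_0`: transport to the ball around `−(1 − g₀)`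
    simp only [Fin.zero_eta, Fin.isValue, cons_val_zero]
    obtain ⟨h1, h2', h3⟩ := repr_ball_image_neg_one_add hc₀ h1c₀ hpe S hS1 hS2 hS3
    have hinj : Set.InjOn (fun g : K => -(1 + g)) ↑S := fun g _ g' _ h => by simpa using h
    rw [← Int.cast_sum, ← Finset.sum_image hinj,
      sum_normSign_eq_zero_of_repr_ball hD h2 hρ (by rw [Valuation.map_neg, h1c₀]) hed _ h1 h2' h3, Int.cast_zero]
  · -- `χ^H_1`: transport to the ball around `g₀∕(1 − g₀)`
    simp only [Fin.mk_one, Fin.isValue, cons_val_one, cons_val_zero]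
    rw [← Int.cast_sum, Finset.sum_congr rfl fun g hg => normSign_mul_normSign_neg_one_add hD (hS1 g hg).1 (hS1 g hg).2.1 (h1S g hg)]
    obtain ⟨h1, h2', h3⟩ := repr_ball_image_moebius hc₀ h1c₀ hpe S hS1 hS2 hS3
    have hinj : Set.InjOn (fun g : K => -g / (1 + g)) ↑S := by
      intro g hg g' hg' h
      have h1g0 : (1 : K) + g ≠ 0 := fun h0 => by have := h1S g hg; rw [h0, map_zero] at this; exact zero_ne_one this
      have h1g'0 : (1 : K) + g' ≠ 0 := fun h0 => by have := h1S g' hg'; rw [h0, map_zero] at this; exact zero_ne_one this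
      have h' := congrArg (fun x : K => -x / (1 + x)) h
      simp only at h'
      rwa [moebius_moebius h1g0, moebius_moebius h1g'0] at h'
    rw [← Finset.sum_image hinj, sum_normSign_eq_zero_of_repr_ball hD h2 hρ (v_moebius hc₀ h1c₀).1 hed _ h1 h2' h3, Int.cast_zero]
  · -- `χ^H_2`
    simp only [Fin.reduceFinMk, cons_val_two, Nat.succ_eq_add_one, Nat.reduceAdd, tail_cons, head_cons]
    rw [← Int.cast_sum, sum_normSign_eq_zero_of_repr_ball hD h2 hρ hc₀ hed S hS1 hS2 hS3, Int.cast_zero]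

/-! ## §3 (T2b) The glue ball with `2d − 1 ≤ e`: `ω` is constant on the ball -/

/-- **(T2b) `Σ_{g ∈ R, |g + g₀| ≤ |ϖ|^e} χ^H_i(g) = #{g ∈ R : |g + g₀| ≤ |ϖ|^e} · χ^H_i(f₀)`** for `2d−1 ≤ e`, `|g₀| = |1 − g₀| = 1`, and any fixed `f₀` with `|f₀ + g₀| ≤ |ϖ|^e`
(all three characters are constant on the `U_F(2d−1)`-coset, toolkit §3 `normSign_eq_of_near`). [cite: Kottwitz1986BaseChangeUnits, §1 pp. 240–241] [cite: Serre1979, Ch. XV §2] -/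
theorem finsum_chiH_glue_eq_ncard_mul [CompleteSpace K] {σ : K →+* K} {ϖ : K} {d t : ℕ} (hD : IsRamifiedQuadraticDatum σ ϖ d t)
    {R : Set K} (hRfin : R.Finite) (hR1 : ∀ g ∈ R, σ g = g ∧ Valued.v g = 1)
    {g₀ : K} (hg₀ : Valued.v g₀ = 1) (h1g₀ : Valued.v (1 - g₀) = 1) {e : ℕ} (hed : 2 * d - 1 ≤ e)
    {f₀ : K} (hσf₀ : σ f₀ = f₀) (hf₀ : Valued.v (f₀ + g₀) ≤ Valued.v ϖ ^ e) (i : Fin 3) :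
    ∑ᶠ g ∈ {g : K | g ∈ R ∧ Valued.v (g + g₀) ≤ Valued.v ϖ ^ e},
      (((![normSign σ (-(1 + g)), normSign σ g * normSign σ (-(1 + g)), normSign σ g] : Fin 3 → ℤ) i : ℤ) : ℚ) =
      ({g : K | g ∈ R ∧ Valued.v (g + g₀) ≤ Valued.v ϖ ^ e}.ncard : ℚ) *
        (((![normSign σ (-(1 + f₀)), normSign σ f₀ * normSign σ (-(1 + f₀)), normSign σ f₀] : Fin 3 → ℤ) i : ℤ) : ℚ) := by
  classical
  have hϖ := hD.2.2.1
  have hd1 := hD.2.2.2.2.2.1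
  have hϖ1 : Valued.v ϖ < 1 := by rw [hϖ, ← exp_zero, exp_lt_exp]; norm_num
  have hpe : Valued.v ϖ ^ e < 1 := pow_lt_one₀ zero_le hϖ1 (by omega)
  -- the letters of `f₀`: a unit with `|1 + f₀| = 1`
  have hvf₀ : Valued.v f₀ = 1 := by
    rw [show f₀ = -g₀ + (f₀ + g₀) by ring]; exact v_add_eq_one_of_lt (by rw [Valuation.map_neg, hg₀]) (hf₀.trans_lt hpe)
  have h1f₀ : Valued.v (-(1 + f₀)) = 1 := by
    rw [Valuation.map_neg, show 1 + f₀ = (1 - g₀) + (f₀ + g₀) by ring]; exact v_add_eq_one_of_lt h1g₀ (hf₀.trans_lt hpe)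
  have hσ1f₀ : σ (-(1 + f₀)) = -(1 + f₀) := by rw [map_neg, map_add, map_one, hσf₀]
  have hAfin : {g : K | g ∈ R ∧ Valued.v (g + g₀) ≤ Valued.v ϖ ^ e}.Finite := hRfin.subset fun g hg => hg.1
  rw [finsum_mem_eq_finite_toFinset_sum _ hAfin, Set.ncard_eq_toFinset_card _ hAfin]
  -- on the ball the three characters are constant
  have hnear : ∀ g ∈ hAfin.toFinset, Valued.v (f₀ - g) ≤ Valued.v ϖ ^ e := fun g hg => by
    rw [show f₀ - g = (f₀ + g₀) - (g + g₀) by ring]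
    exact Valuation.map_sub_le _ hf₀ ((Set.Finite.mem_toFinset hAfin).1 hg).2
  have hω : ∀ g ∈ hAfin.toFinset, normSign σ g = normSign σ f₀ := fun g hg =>
    normSign_eq_of_near hD hσf₀ (hR1 g ((Set.Finite.mem_toFinset hAfin).1 hg).1).1 hvf₀ hed (hnear g hg)
  have hω' : ∀ g ∈ hAfin.toFinset, normSign σ (-(1 + g)) = normSign σ (-(1 + f₀)) := fun g hg =>
    normSign_eq_of_near hD hσ1f₀ (by rw [map_neg, map_add, map_one, (hR1 g ((Set.Finite.mem_toFinset hAfin).1 hg).1).1]) h1f₀ hed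
      (by rw [show -(1 + f₀) - -(1 + g) = -(f₀ - g) by ring, Valuation.map_neg]; exact hnear g hg)
  rw [Finset.sum_congr rfl fun g hg => by rw [hω g hg, hω' g hg], Finset.sum_const, nsmul_eq_mul]

end Summit.HodgeConjecture.HodgeConjecture.Cruxes.H413.F0P3cDyRamDiagonalKappaCoreHangingCharacterSums

end
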